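import Summits.QuantumFields.YangMills.Theorems.BalabanUVNodesN15KingModelThm33AtRegularFieldBox
import Summits.QuantumFields.YangMills.Theorems.BalabanUVNodesN15KingModelThm33AtRegularFieldRegion

/-!
# Route «BalabanUVNodes», node N15 = NE2 — THE KING-MODEL RUNG, PART Θ⁺⁺⁺-d: THE COORDINATE STAIRCASES STAY INSIDE AN INTERVAL BOX — King 1986
# Theorem 3.3 on a big-block INTERVAL BOX at a regular background WITHOUT ANY EXTRA HYPOTHESIS (the contour hypothesis of PART Θ⁺⁺⁺-c discharged)

Cell `pub-ymgap`, Track A (D-0062), seat `pub-ymgap-dag-n15-e` (R141 (C), s3), generation 21.  `bears_on: R4∕N15`; `--supports stmt-QuantumFields-27366`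
(K3⁸, `--as helper`).  COUNT-NEUTRAL.  Namespace `…N15KingModelRung.Curved`.

THE POINT.  PART Θ⁺⁺⁺-c proves King's Theorem 3.3 on a cell-product box `Ω = cellBox k K₀ S` for every admissible contour system `Γ` INSIDE `Ω`.  Here:
p26's coordinatewise shortest staircase `legs` (`B3Ineq211RegularTorus`, the contour behind `exists_isAdm`: each coordinate walked along its shorter arc,
King's coordinate contours (2.12)) stays inside every INTERVAL BOX `Ω = Π_μ {x : lo_μM ≤ x_μ < hi_μM}` whose sides are at most half the torus
(`2(hi_μ − lo_μ)M ≤ |T_ε|_μ`): between two points of such an interval the shorter arc cannot leave it (it would have to be longer than half the period).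
Hence ★★★ `thm33Printed_king_regularField_intervalBox`: Theorem 3.3 BY NAME, all nine clauses, no `R₀`, on every such box, transports along `legsK`.

WHAT THIS FILE PROVES (0 `sorry`; one dictionary `def`).  `legsK y x` (the staircase from `y` to `x` over all coordinates), `legsK_isAdm`; `mem_stepsFwd`,
`mem_stepsBwd` (the sites of a run); the arc lemmas `arc_fwd_mem` ∕ `arc_bwd_mem` in `ZMod n`; `mem_intervalBox_iff`, `leg_subset_box`, `update_mem_box`,
`legs_subset_box`, ★★ `legsK_subset_intervalBox`;
★★★ `thm33Printed_king_regularField_intervalBox`; `intervalBox_family_nonempty` (the hypotheses are met: one big block per direction on r14's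
cubic tori, corner `0` bond-closed).  [cite: King1986, (2.12) p.653, Thm 3.3 p.655 «rectangular parallelepiped which is a union of large blocks»]
[cite: Balaban1982Higgs1, (1.3) p.604, Prop. 2.1 p.610 «a shortest contour», p.611 l.1–2]

HONEST FRAMING ∕ SCOPE.  Elementary torus arithmetic; scope otherwise as PART Θ⁺⁺⁺-c (bond-closed carrier `bset Ω`, regularity on all of `T_ε`, cubic tori,
`L ∣ K₀`, constants per `K₀`); boxes with a side longer than half the torus are not covered (there the shorter arc may leave the box).  NOT Bałaban's
non-abelian `G(U)`; NE2⁺ NOT printed ∕ not proved; NOT a node discharge; counts untouched; nothing continuum ∕ ℝ⁴ ∕ OS ∕ mass-gap ∕ Clay.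
-/

noncomputable section

namespace Summit.QuantumFields.YangMills.BalabanUVNodes.N15KingModelRung.Curved

open Literature.MathematicalPhysics.QuantumFieldTheory.Balaban1983to89
open Literature.MathematicalPhysics.QuantumFieldTheory.Balaban1983to89.HiggsLattice (ChargeData)
open Literature.MathematicalPhysics.QuantumFieldTheory.Balaban1983to89.B1Eq211ZeroFieldTorus (Shape)
open Literature.MathematicalPhysics.QuantumFieldTheory.Balaban1983to89.B1TorusCubeCover (half)
open Literature.MathematicalPhysics.QuantumFieldTheory.Balaban1983to89.B1Ineq225RegularBox (cellOf cellBox mem_cellBox)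
open Literature.MathematicalPhysics.QuantumFieldTheory.Balaban1983to89.B3Ineq211RegularTorus (IsAdm stepsFwd stepsBwd leg legs isTChain_legs
  pathEnd_legs length_legs_le)
open Literature.MathematicalPhysics.QuantumFieldTheory.King1986.ContinuumLimit (Thm33Printed)

variable {N : ℕ} {P : HiggsLattice.Params}

/-! ## §1 The coordinate staircase and the sites it visits -/

/-- THE COORDINATE STAIRCASE `Γ_{y,x}` from `y` to `x`: p26's `legs` over all directions (each coordinate along its shorter arc; King's coordinate
contours (2.12)). [cite: King1986, (2.12) p.653] [cite: Balaban1982Higgs1, Prop. 2.1 p.610 «a shortest contour connecting these points»] -/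
def legsK (y x : HiggsLattice.Site P 0) : List (HiggsLattice.Site P 0) := legs x y (List.finRange P.d)

/-- the coordinate staircase is admissible (a chain from `y` to `x` of length `≤ d|x − y|`; p26's `exists_isAdm` verbatim). [cite: Balaban1982Higgs1, Prop. 2.1 p.610] -/
theorem legsK_isAdm (y x : HiggsLattice.Site P 0) : IsAdm y x (legsK y x) := by
  refine ⟨isTChain_legs x y _, ?_, ?_⟩
  · unfold legsK; rw [pathEnd_legs]; funext ν; simp
  · have h := length_legs_le y x y (List.finRange P.d) fun ν => Or.inl rfl
    rw [List.length_finRange] at h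
    unfold legsK
    exact_mod_cast h

/-- the sites of a forward run: `x + ie_μ`, `1 ≤ i ≤ n`. [cite: Balaban1982Higgs1, (1.2) p.604] -/
theorem mem_stepsFwd (μ : Fin P.d) : ∀ (x : HiggsLattice.Site P 0) (n : ℕ) (z : HiggsLattice.Site P 0),
    z ∈ stepsFwd μ x n → ∃ i : ℕ, 1 ≤ i ∧ i ≤ n ∧ z = Function.update x μ (x μ + i)
  | x, 0, z, h => by simp [stepsFwd] at h
  | x, n + 1, z, h => by
    rw [stepsFwd, List.mem_cons] at h
    rcases h with h | h
    · exact ⟨1, le_rfl, by omega, by rw [h]; simp [HiggsLattice.Site.shift]⟩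
    · obtain ⟨i, hi1, hin, hz⟩ := mem_stepsFwd μ (x.shift μ) n z h
      refine ⟨i + 1, by omega, by omega, ?_⟩
      rw [hz]
      simp only [HiggsLattice.Site.shift, Function.update_idem, Function.update_self, Nat.cast_succ]
      congr 1; ring

/-- the sites of a backward run: `x − ie_μ`, `1 ≤ i ≤ n`. [cite: Balaban1982Higgs1, (1.2) p.604] -/
theorem mem_stepsBwd (μ : Fin P.d) : ∀ (x : HiggsLattice.Site P 0) (n : ℕ) (z : HiggsLattice.Site P 0),
    z ∈ stepsBwd μ x n → ∃ i : ℕ, 1 ≤ i ∧ i ≤ n ∧ z = Function.update x μ (x μ - i)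
  | x, 0, z, h => by simp [stepsBwd] at h
  | x, n + 1, z, h => by
    rw [stepsBwd, List.mem_cons] at h
    rcases h with h | h
    · exact ⟨1, le_rfl, by omega, by rw [h]; simp [HiggsLattice.Site.unshift]⟩
    · obtain ⟨i, hi1, hin, hz⟩ := mem_stepsBwd μ (x.unshift μ) n z h
      refine ⟨i + 1, by omega, by omega, ?_⟩
      rw [hz]
      simp only [HiggsLattice.Site.unshift, Function.update_idem, Function.update_self, Nat.cast_succ]
      congr 1; ring

/-! ## §2 The shorter arc between two points of a short interval stays in the interval -/

/-- forward arc: if `u, v ∈ [A, B)`, `2(B − A) ≤ n` and the forward arc `u → v` is the shorter one, its points lie in `[A, B)`. [folklore] -/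
theorem arc_fwd_mem {n : ℕ} [NeZero n] {A B : ℕ} (hAB : 2 * (B - A) ≤ n) {u v : ZMod n} (huA : A ≤ u.val) (huB : u.val < B)
    (hvA : A ≤ v.val) (hvB : v.val < B) (hfwd : (v - u).val ≤ (u - v).val) {i : ℕ} (hi : i ≤ (v - u).val) :
    A ≤ (u + (i : ZMod n)).val ∧ (u + (i : ZMod n)).val < B := by
  have hn : 0 < n := Nat.pos_of_ne_zero (NeZero.ne n)
  by_cases hle : u.val ≤ v.val
  · have hvu : (v - u).val = v.val - u.val := ZMod.val_sub hle
    rw [hvu] at hi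
    have hin : i < n := by have := ZMod.val_lt v; omega
    have hiv : (i : ZMod n).val = i := by rw [ZMod.val_natCast, Nat.mod_eq_of_lt hin]
    have hsum : u.val + (i : ZMod n).val < n := by rw [hiv]; have := ZMod.val_lt v; omega
    rw [ZMod.val_add_of_lt hsum, hiv]
    constructor <;> omega
  · -- the forward arc would be the longer one
    exfalso
    push Not at hle
    have huv : (u - v).val = u.val - v.val := ZMod.val_sub hle.le
    have hne : u - v ≠ 0 := by
      intro h0; have := congrArg ZMod.val h0; rw [huv, ZMod.val_zero] at this; omega
    have hvu : (v - u).val = n - (u.val - v.val) := by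
      rw [← neg_sub, ZMod.neg_val, if_neg hne, huv]
    rw [hvu, huv] at hfwd
    omega

/-- backward arc: if `u, v ∈ [A, B)`, `2(B − A) ≤ n` and the backward arc `u → v` is the shorter one, its points lie in `[A, B)`. [folklore] -/
theorem arc_bwd_mem {n : ℕ} [NeZero n] {A B : ℕ} (hAB : 2 * (B - A) ≤ n) {u v : ZMod n} (huA : A ≤ u.val) (huB : u.val < B)
    (hvA : A ≤ v.val) (hvB : v.val < B) (hbwd : ¬ (v - u).val ≤ (u - v).val) {i : ℕ} (hi : i ≤ (u - v).val) :
    A ≤ (u - (i : ZMod n)).val ∧ (u - (i : ZMod n)).val < B := by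
  have hn : 0 < n := Nat.pos_of_ne_zero (NeZero.ne n)
  by_cases hle : v.val ≤ u.val
  · have huv : (u - v).val = u.val - v.val := ZMod.val_sub hle
    rw [huv] at hi
    have hin : i < n := by have := ZMod.val_lt u; omega
    have hiv : (i : ZMod n).val = i := by rw [ZMod.val_natCast, Nat.mod_eq_of_lt hin]
    have hsub : (u - (i : ZMod n)).val = u.val - i := by rw [ZMod.val_sub (by rw [hiv]; omega), hiv]
    rw [hsub]
    constructor <;> omega
  · exfalso
    push Not at hle
    have hvu : (v - u).val = v.val - u.val := ZMod.val_sub hle.le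
    have hne : v - u ≠ 0 := by
      intro h0; have := congrArg ZMod.val h0; rw [hvu, ZMod.val_zero] at this; omega
    have huv : (u - v).val = n - (v.val - u.val) := by
      rw [← neg_sub, ZMod.neg_val, if_neg hne, hvu]
    rw [hvu, huv] at hbwd
    omega

/-! ## §3 Interval boxes are staircase-convex -/

section Box

variable (k K₀ : ℕ) (lo hi : Fin P.d → ℕ)

/-- membership in the interval box `cellBox k K₀ (μ ↦ [lo_μ, hi_μ))` in fine coordinates: `lo_μM ≤ x_μ < hi_μM`. [cite: Balaban1982Higgs1, Prop. 2.1 p.611] -/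
theorem mem_intervalBox_iff (hK₀ : 1 ≤ K₀) (x : HiggsLattice.Site P 0) :
    x ∈ cellBox k K₀ (fun μ => Finset.Ico (lo μ) (hi μ)) ↔
      ∀ μ, lo μ * half P k K₀ ≤ (x μ).val ∧ (x μ).val < hi μ * half P k K₀ := by
  have hh : 0 < half P k K₀ := B1TorusCubeCover.half_pos hK₀
  rw [mem_cellBox]
  refine forall_congr' fun μ => ?_
  unfold cellOf
  rw [Finset.mem_Ico, Nat.le_div_iff_mul_le hh, Nat.div_lt_iff_lt_mul hh]

variable {k K₀ lo hi}

/-- one leg between two points of a short interval box stays in the box. [cite: Balaban1982Higgs1, (1.3) p.604, Prop. 2.1 p.611] -/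
theorem leg_subset_box (hK₀ : 1 ≤ K₀) (hside : ∀ μ, 2 * ((hi μ - lo μ) * half P k K₀) ≤ P.sitesPerDir 0 μ)
    {x y : HiggsLattice.Site P 0} (hx : x ∈ cellBox k K₀ (fun μ => Finset.Ico (lo μ) (hi μ)))
    (hy : y ∈ cellBox k K₀ (fun μ => Finset.Ico (lo μ) (hi μ))) (μ : Fin P.d) :
    ∀ z ∈ leg x y μ, z ∈ cellBox k K₀ (fun μ => Finset.Ico (lo μ) (hi μ)) := by
  intro z hz
  rw [mem_intervalBox_iff k K₀ lo hi hK₀] at hx hy ⊢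
  have hAB : 2 * (hi μ * half P k K₀ - lo μ * half P k K₀) ≤ P.sitesPerDir 0 μ := by rw [← Nat.sub_mul]; exact hside μ
  unfold leg at hz
  split_ifs at hz with hcase
  · obtain ⟨i, _, hin, rfl⟩ := mem_stepsFwd μ x _ z hz
    intro ν
    by_cases hν : ν = μ
    · subst hν
      rw [Function.update_self]
      exact arc_fwd_mem hAB (hx ν).1 (hx ν).2 (hy ν).1 (hy ν).2 hcase hin
    · rw [Function.update_of_ne hν]; exact hx ν
  · obtain ⟨i, _, hin, rfl⟩ := mem_stepsBwd μ x _ z hz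
    intro ν
    by_cases hν : ν = μ
    · subst hν
      rw [Function.update_self]
      exact arc_bwd_mem hAB (hx ν).1 (hx ν).2 (hy ν).1 (hy ν).2 hcase hin
    · rw [Function.update_of_ne hν]; exact hx ν

/-- a coordinate mix of two points of a box is in the box (the box is a product). [cite: Balaban1982Higgs1, Prop. 2.1 p.611] -/
theorem update_mem_box (hK₀ : 1 ≤ K₀) {x y : HiggsLattice.Site P 0} (hx : x ∈ cellBox k K₀ (fun μ => Finset.Ico (lo μ) (hi μ)))
    (hy : y ∈ cellBox k K₀ (fun μ => Finset.Ico (lo μ) (hi μ))) (μ : Fin P.d) :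
    Function.update x μ (y μ) ∈ cellBox k K₀ (fun μ => Finset.Ico (lo μ) (hi μ)) := by
  rw [mem_intervalBox_iff k K₀ lo hi hK₀] at hx hy
  refine (mem_intervalBox_iff k K₀ lo hi hK₀ _).2 fun ν => ?_
  by_cases hν : ν = μ
  · subst hν; rw [Function.update_self]; exact hy ν
  · rw [Function.update_of_ne hν]; exact hx ν

/-- all legs between two points of a short interval box stay in the box. [cite: Balaban1982Higgs1, Prop. 2.1 p.611] -/
theorem legs_subset_box (hK₀ : 1 ≤ K₀) (hside : ∀ μ, 2 * ((hi μ - lo μ) * half P k K₀) ≤ P.sitesPerDir 0 μ)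
    {y : HiggsLattice.Site P 0} (hy : y ∈ cellBox k K₀ (fun μ => Finset.Ico (lo μ) (hi μ))) :
    ∀ (x : HiggsLattice.Site P 0) (ms : List (Fin P.d)), x ∈ cellBox k K₀ (fun μ => Finset.Ico (lo μ) (hi μ)) →
      ∀ z ∈ legs y x ms, z ∈ cellBox k K₀ (fun μ => Finset.Ico (lo μ) (hi μ))
  | x, [], _, z, hz => by simp [legs] at hz
  | x, μ :: ms, hx, z, hz => by
    rw [legs, List.mem_append] at hz
    rcases hz with hz | hz
    · exact leg_subset_box hK₀ hside hx hy μ z hz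
    · exact legs_subset_box hK₀ hside hy _ ms (update_mem_box hK₀ hx hy μ) z hz

/-- ★★ **THE COORDINATE STAIRCASES STAY INSIDE A SHORT INTERVAL BOX**: for `x, y` in the box, `legsK y x ⊂` box. [cite: King1986, (2.12) p.653]
[cite: Balaban1982Higgs1, Prop. 2.1 p.610 «a shortest contour», p.611 l.1–2] -/
theorem legsK_subset_intervalBox (hK₀ : 1 ≤ K₀) (hside : ∀ μ, 2 * ((hi μ - lo μ) * half P k K₀) ≤ P.sitesPerDir 0 μ)
    (x y : HiggsLattice.Site P 0) (hx : x ∈ cellBox k K₀ (fun μ => Finset.Ico (lo μ) (hi μ)))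
    (hy : y ∈ cellBox k K₀ (fun μ => Finset.Ico (lo μ) (hi μ))) : ∀ z ∈ legsK y x, z ∈ cellBox k K₀ (fun μ => Finset.Ico (lo μ) (hi μ)) :=
  legs_subset_box hK₀ hside hx y (List.finRange P.d) hy

end Box

/-! ## §4 Theorem 3.3 on an interval box, no extra hypothesis -/

/-- ★★★ **KING 1986 THEOREM 3.3 BY NAME AT A REGULAR BACKGROUND ON A BIG-BLOCK INTERVAL BOX `Ω = Π_μ[lo_μM, hi_μM) ⊂ T_ε` WITH SIDES AT MOST HALF THE
TORUS — ALL NINE CLAUSES, THE `δ`-CLAUSES LIVE, NO `R₀`-RESTRICTION, NO CONTOUR HYPOTHESIS** (transports along the coordinate staircases `legsK`; PART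
Θ⁺⁺⁺-c + `legsK_subset_intervalBox`). [cite: King1986, Thm 3.3 (3.6)–(3.8) pp.655–656] [cite: Balaban1982Higgs1, Prop. 2.1 (2.24)–(2.26) p.610, p.611 l.1–2]
[cite: Balaban1983RegularityDecay, Theorem (1.9)–(1.12) p.573, p.579] -/
theorem thm33Printed_king_regularField_intervalBox (d L : ℕ) (hd : 1 ≤ d) (hL : Odd L ∧ 1 < L) {a msq : ℝ} (ha : 0 < a) (hmsq : 0 < msq)
    (N : ℕ) (C : ChargeData N) :
    ∃ K₀min : ℕ, ∀ K₀ : ℕ, K₀min ≤ K₀ → L ∣ K₀ → ∃ t : ℝ, 0 < t ∧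
      ∀ (P : HiggsLattice.Params) (_S : Shape P), P.d = d → P.L = L → K₀ ∣ P.M → 3 * K₀ ≤ 2 * P.M →
      ∀ {k : ℕ}, 1 ≤ k → k < P.K → P.mesh k ≤ 1 →
      ∀ (lo hi : Fin P.d → ℕ), (∀ μ, 2 * ((hi μ - lo μ) * half P k K₀) ≤ P.sitesPerDir 0 μ) →
      ∀ (A : HiggsLattice.VecField P 0) {δ : ℝ}, 0 ≤ δ →
        (∀ (z : HiggsLattice.Site P 0) (μ ν : Fin P.d), |A ⟨z.shift ν, μ⟩ - A ⟨z, μ⟩| ≤ δ) →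
        (P.L : ℝ) ^ k * δ * |C.e| ≤ t →
        Thm33Printed (kingThm33DataAlong C P k (cellBox k K₀ (fun μ => Finset.Ico (lo μ) (hi μ)))
          (bset (cellBox k K₀ (fun μ => Finset.Ico (lo μ) (hi μ)))) (fun y x => legsK y x) A a msq) := by
  obtain ⟨K₀min, h⟩ := thm33Printed_king_regularField_box d L hd hL ha hmsq N C
  refine ⟨max K₀min 1, fun K₀ hK₀ hLK₀ => ?_⟩
  have hK₀1 : 1 ≤ K₀ := (le_max_right _ _).trans hK₀
  obtain ⟨t, ht, h'⟩ := h K₀ ((le_max_left _ _).trans hK₀) hLK₀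
  exact ⟨t, ht, fun P S hPd hPL hK₀M h3M k hk1 hkK hs lo hi hside A δ hδ hreg hle =>
    h' P S hPd hPL hK₀M h3M hk1 hkK hs (fun μ => Finset.Ico (lo μ) (hi μ)) (fun y x => legsK y x) (fun y x => legsK_isAdm y x)
      (fun x y hx hy => legsK_subset_intervalBox hK₀1 hside x y hx hy) A hδ hreg hle⟩

/-- NON-VACUITY OF THE INTERVAL-BOX FAMILY: above every cube-size threshold there is an admissible cube size `K₀ = L^r` (`L ∣ K₀`), a cubic torus and a
level meeting all the side conditions of `thm33Printed_king_regularField_intervalBox`, on which the ONE-BIG-BLOCK box `Π_μ[0, M)` has sides at most half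
the torus (`3M ≤ |T_ε|_μ`) and a non-empty bond-closed carrier (the corner `0` and its `d` forward neighbours lie in the block, `M = L^kK₀ ≥ 2`).
[cite: King1986, Thm 3.3 p.655] [cite: Balaban1983RegularityDecay, §2 p.575] -/
theorem intervalBox_family_nonempty (d L K₀min : ℕ) (hd : 1 ≤ d) (hL : Odd L ∧ 1 < L) :
    ∃ K₀ : ℕ, K₀min ≤ K₀ ∧ L ∣ K₀ ∧ ∃ (P : HiggsLattice.Params) (_S : Shape P) (k : ℕ),
      P.d = d ∧ P.L = L ∧ K₀ ∣ P.M ∧ 3 * K₀ ≤ 2 * P.M ∧ 1 ≤ k ∧ k < P.K ∧ P.mesh k ≤ 1 ∧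
      (∀ μ, 2 * ((1 - 0) * half P k K₀) ≤ P.sitesPerDir 0 μ) ∧
      (bset (cellBox k K₀ (fun _ : Fin P.d => Finset.Ico 0 1))).Nonempty := by
  obtain ⟨K₀, hK₀, hLK₀, P, S, k, hPd, hPL, hK₀M, h3M, hk1, hkK, hs, -⟩ := thm33_region_family_nonempty d L (max K₀min 1) hd hL
  have hK₀1 : 1 ≤ K₀ := (le_max_right _ _).trans hK₀
  replace hK₀ : K₀min ≤ K₀ := (le_max_left _ _).trans hK₀
  have hN3 : ∀ μ, 3 * half P k K₀ ≤ P.sitesPerDir 0 μ := fun μ => B1Ineq225BackgroundTorus.three_half_le_sites hkK.le h3M μ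
  have hhalf2 : 2 ≤ half P k K₀ := by
    unfold half
    have h1 : P.L ≤ P.L ^ k := by
      calc P.L = P.L ^ 1 := (pow_one _).symm
        _ ≤ P.L ^ k := Nat.pow_le_pow_right P.hL hk1
    have h2 : 2 ≤ P.L := by rw [hPL]; exact hL.2
    nlinarith [h1, h2, hK₀1]
  refine ⟨K₀, hK₀, hLK₀, P, S, k, hPd, hPL, hK₀M, h3M, hk1, hkK, hs, fun μ => by have := hN3 μ; omega, ?_⟩
  -- the corner `0` is bond-closed in the block `Π_μ[0, M)`
  refine ⟨fun _ => 0, mem_bset.2 ⟨?_, fun μ => ?_⟩⟩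
  · refine (mem_intervalBox_iff k K₀ (fun _ => 0) (fun _ => 1) hK₀1 _).2 fun ν => ?_
    rw [ZMod.val_zero]; constructor <;> omega
  · refine (mem_intervalBox_iff k K₀ (fun _ => 0) (fun _ => 1) hK₀1 _).2 fun ν => ?_
    have hn1 : 1 < P.sitesPerDir 0 ν := by have := hN3 ν; omega
    by_cases hν : ν = μ
    · subst hν
      simp only [HiggsLattice.Site.shift, Function.update_self, zero_add]
      haveI : Fact (1 < P.sitesPerDir 0 ν) := ⟨hn1⟩
      rw [ZMod.val_one]
      constructor <;> omega
    · simp only [HiggsLattice.Site.shift, Function.update_of_ne hν, ZMod.val_zero]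
      constructor <;> omega

end Summit.QuantumFields.YangMills.BalabanUVNodes.N15KingModelRung.Curved

end
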